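import Summits.Ventures.PercRepro.C041TriDomGlueGenericS

/-!
# ROW C-041 — GLUING AT A CUT VERTEX, VII: THE SIBLING DOMINATION ACROSS EVERY CUT VERTEX — THE FAMILY IS CLOSED
(p6, gen 45; P6-TWOEXIT-LEAN.md §53 ADDENDUM 16)

The sibling domination `SibDominationS Z₁ x y t` (marks `x, y`, terminal `t`) reduces across a cut vertex `w`
exactly like the conjecture (THEOREM (GENERIC FIBRE COUNT)), and the near-side statements it needs are AGAIN
sibling dominations (with the cut vertex replacing the separated vertex) and THEOREM (TWO-MARK DOMINATION) in an
up-set window: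

* `w` separates the TERMINAL `t` from `x, y` (`sibDominationS_of_cutVertex_terminal`): needs `Sib(x, y; w)`;
* `w` separates the mark `x` from `y, t` (`sibDominationS_of_cutVertex_markx`): needs `Sib(w, y; t)`;
* `w` separates the mark `y` from `x, t` (`sibDominationS_of_cutVertex_marky`): needs `Sib(x, w; t)`.

Together with `cycDomination_of_cutVertex` (the conjecture needs the conjecture and the sibling on the near side),
the family `{CONJECTURE (STOCHASTIC DOMINATION), SIBLING}` is closed under gluing at cut vertices: THE CONJECTURE
HOLDS ON EVERY HOST IFF IT AND THE SIBLING HOLD ON THE HOSTS WITHOUT A CUT VERTEX (ADDENDUM 16, the reduction to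
2-connected hosts — the induction on the number of edges is on paper; every single step is in the kernel).
-/

namespace PercRepro

namespace ZoneZ

namespace MultiExit

open ZoneData Finset

variable {V₁ E₁ U₁ U₂ : Type} (Z₁ : ZoneData V₁ E₁ U₁ U₂) (st : E₁ → EStat)

/-! ## Symmetry, monotonicity, the window -/

/-- Red connectivity is symmetric. -/
theorem RdS_comm (ω : E₁ → Bool) (a b : V₁) : RdS Z₁ st ω a b ↔ RdS Z₁ st ω b a :=
  ⟨fun h => reach_trans_of_symm (RAdjS_symm Z₁ st ω) h (mem_reach_self _ _),
    fun h => reach_trans_of_symm (RAdjS_symm Z₁ st ω) h (mem_reach_self _ _)⟩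

/-- Blue connectivity is symmetric. -/
theorem MgS_comm (ω : E₁ → Bool) (a b : V₁) : MgS Z₁ st ω a b ↔ MgS Z₁ st ω b a :=
  ⟨fun h => reach_trans_of_symm (BAdjS_symm Z₁ st ω) h (mem_reach_self _ _),
    fun h => reach_trans_of_symm (BAdjS_symm Z₁ st ω) h (mem_reach_self _ _)⟩

/-- Red connectivity composes (any status). -/
theorem RdS_trans_st (ω : E₁ → Bool) {a b c : V₁} (h1 : RdS Z₁ st ω a b)
    (h2 : RdS Z₁ st ω a c) : RdS Z₁ st ω b c :=
  reach_trans_of_symm (RAdjS_symm Z₁ st ω) h1 h2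

/-- Red connectivity is monotone in the colouring, for any status. -/
theorem RdS_mono_st {ω ω' : E₁ → Bool} (h : LeCol ω ω') {k v : V₁}
    (hr : RdS Z₁ st ω k v) : RdS Z₁ st ω' k v := by
  unfold RdS at hr ⊢
  refine reach_mono (fun x y hxy => ?_) hr
  obtain ⟨e, hj, he⟩ := hxy
  refine ⟨e, hj, ?_⟩
  unfold redE at he ⊢
  rcases he with he | ⟨hf, he⟩
  · exact Or.inl he
  · exact Or.inr ⟨hf, h e he⟩

/-- The colourings in which `a, c` are red-connected form an up-set, inside any up-set. -/
theorem upSet_and_RdS (a c : V₁) {V : (E₁ → Bool) → Prop} (hV : UpSet V) :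
    UpSet fun ω => V ω ∧ RdS Z₁ st ω a c := by
  intro ω ω' hω hle
  exact ⟨hV _ _ hω.1 hle, RdS_mono_st Z₁ st hle hω.2⟩

/-- Red connectivity through `v` decomposes (the far vertex first). -/
theorem RdS_st_iff_through' (v z : V₁) (hz : z ≠ v) (ω : E₁ → Bool) {a c : V₁}
    (ha : a ∉ side Z₁ st v z) (hc : c ∈ side Z₁ st v z) :
    RdS Z₁ st ω c a ↔ RdS Z₁ (stOutS Z₁ st v z) ω a v ∧ RdS Z₁ (stInS Z₁ st v z) ω v c := by
  rw [RdS_comm, RdS_st_iff_through Z₁ st v z hz ω ha hc]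

/-- Blue connectivity through `v` decomposes (the far vertex first). -/
theorem MgS_st_iff_through' (v z : V₁) (hz : z ≠ v) (ω : E₁ → Bool) {a c : V₁}
    (ha : a ∉ side Z₁ st v z) (hc : c ∈ side Z₁ st v z) :
    MgS Z₁ st ω c a ↔ MgS Z₁ (stOutS Z₁ st v z) ω a v ∧ MgS Z₁ (stInS Z₁ st v z) ω v c := by
  rw [MgS_comm, MgS_st_iff_through Z₁ st v z hz ω ha hc]

section Counting

variable [Fintype E₁] [DecidableEq E₁]

open Classical in
/-- THEOREM (TWO-MARK DOMINATION) in the window «`a ~_R c`»: blue `a–b` is outnumbered by red `a–b`. -/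
theorem count_window (a b c : V₁) {V : (E₁ → Bool) → Prop} (hV : UpSet V) :
    (univ.filter fun ω : E₁ → Bool => V ω ∧ (RdS Z₁ st ω a c ∧ MgS Z₁ st ω a b)).card ≤
      (univ.filter fun ω : E₁ → Bool => V ω ∧ (RdS Z₁ st ω a c ∧ RdS Z₁ st ω a b)).card := by
  have h := count_blue_le_count_red_S Z₁ st a b (upSet_and_RdS Z₁ st a c hV)
  exact (card_filter_congr' fun ω _ => by tauto).trans_le (h.trans_eq (card_filter_congr' fun ω _ => by tauto))

open Classical in
/-- The window statement with the target closed under transitivity (`a ~_R c`, `a ~_R b` give `b ~_R c`). -/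
theorem count_window' (a b c : V₁) {V : (E₁ → Bool) → Prop} (hV : UpSet V) :
    (univ.filter fun ω : E₁ → Bool => V ω ∧ (RdS Z₁ st ω a c ∧ MgS Z₁ st ω a b)).card ≤
      (univ.filter fun ω : E₁ → Bool =>
        V ω ∧ (RdS Z₁ st ω a c ∧ RdS Z₁ st ω a b ∧ RdS Z₁ st ω b c)).card := by
  refine (count_window Z₁ st a b c hV).trans_eq (card_filter_congr' fun ω _ => ?_)
  constructor
  · rintro ⟨hv, h1, h2⟩
    exact ⟨hv, h1, h2, RdS_trans_st Z₁ st ω h2 h1⟩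
  · rintro ⟨hv, h1, h2, _⟩
    exact ⟨hv, h1, h2⟩

open Classical in
/-- The window statement, the last conjunct oriented `c ~_R b`. -/
theorem count_window_tw (a b c : V₁) {V : (E₁ → Bool) → Prop} (hV : UpSet V) :
    (univ.filter fun ω : E₁ → Bool => V ω ∧ (RdS Z₁ st ω a c ∧ MgS Z₁ st ω a b)).card ≤
      (univ.filter fun ω : E₁ → Bool =>
        V ω ∧ (RdS Z₁ st ω a c ∧ RdS Z₁ st ω a b ∧ RdS Z₁ st ω c b)).card :=
  (count_window' Z₁ st a b c hV).trans_eq (card_filter_congr' fun ω _ => by rw [RdS_comm Z₁ st ω b c])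

end Counting

/-! ## Merge invariance for arbitrary marks -/

variable (z v : V₁)

open Classical in
/-- The sibling's first class of `stOut` depends only on the outside part (any marks). -/
theorem sibC₁_stOutS_merge' (a b c : V₁) (o i : E₁ → Bool) :
    SibC₁ Z₁ a b c (stOutS Z₁ st v z) (merge (InCS Z₁ st v z) o i) ↔ SibC₁ Z₁ a b c (stOutS Z₁ st v z) o := by
  unfold SibC₁
  simp only [RdS_stOutS_merge, MgS_stOutS_merge]

open Classical in
/-- The sibling's second class of `stOut` depends only on the outside part (any marks). -/
theorem sibC₃_stOutS_merge' (a b c : V₁) (o i : E₁ → Bool) :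
    SibC₃ Z₁ a b c (stOutS Z₁ st v z) (merge (InCS Z₁ st v z) o i) ↔ SibC₃ Z₁ a b c (stOutS Z₁ st v z) o := by
  unfold SibC₃
  simp only [RdS_stOutS_merge, MgS_stOutS_merge]

open Classical in
/-- The sibling's target of `stOut` depends only on the outside part (any marks). -/
theorem sibTop_stOutS_merge' (a b c : V₁) (o i : E₁ → Bool) :
    SibTop Z₁ a b c (stOutS Z₁ st v z) (merge (InCS Z₁ st v z) o i) ↔ SibTop Z₁ a b c (stOutS Z₁ st v z) o := by
  unfold SibTop
  simp only [RdS_stOutS_merge, MgS_stOutS_merge]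

/-! ## Case A: the cut vertex separates the terminal -/

section Terminal

variable (x y t w : V₁)

open Classical in
/-- The sibling's classes split across a cut vertex separating the terminal. -/
theorem sibSrcS_merge_iff_terminal (ht : t ≠ w) (hx : x ∉ side Z₁ st w t)
    (hy : y ∉ side Z₁ st w t) (o i : E₁ → Bool) :
    (SibC₁ Z₁ x y t st (merge (InCS Z₁ st w t) o i) ∨
        SibC₃ Z₁ x y t st (merge (InCS Z₁ st w t) o i)) ↔
      (tDinS Z₁ st t w i ∧ (SibC₁ Z₁ x y w (stOutS Z₁ st w t) o ∨ SibC₃ Z₁ x y w (stOutS Z₁ st w t) o)) ∨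
        (tRinS Z₁ st t w i ∧ SibC₃ Z₁ x y w (stOutS Z₁ st w t) o) ∨
        (tBinS Z₁ st t w i ∧ SibC₁ Z₁ x y w (stOutS Z₁ st w t) o) ∨ (tNinS Z₁ st t w i ∧ False) := by
  have htC : t ∈ side Z₁ st w t := mem_reach_self _ _
  unfold SibC₁ SibC₃ tDinS tRinS tBinS tNinS
  rw [RdS_st_iff_out Z₁ st w t ht _ hx hy, RdS_st_iff_through Z₁ st w t ht _ hx htC,
    RdS_st_iff_through Z₁ st w t ht _ hy htC, MgS_st_iff_out Z₁ st w t ht _ hx hy,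
    MgS_st_iff_through Z₁ st w t ht _ hx htC, MgS_st_iff_through Z₁ st w t ht _ hy htC,
    RdS_stOutS_merge, RdS_stOutS_merge, RdS_stOutS_merge, RdS_stInS_merge, MgS_stOutS_merge, MgS_stOutS_merge,
    MgS_stOutS_merge, MgS_stInS_merge]
  by_cases hR : RdS Z₁ (stInS Z₁ st w t) i w t <;> by_cases hB : MgS Z₁ (stInS Z₁ st w t) i w t
  all_goals
    simp only [hR, hB, and_true, and_false, not_true_eq_false, not_false_eq_true, true_and, false_and, or_false,
      false_or]

open Classical in
/-- The sibling's target splits across a cut vertex separating the terminal. -/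
theorem sibTopS_merge_iff_terminal (ht : t ≠ w) (hx : x ∉ side Z₁ st w t)
    (hy : y ∉ side Z₁ st w t) (o i : E₁ → Bool) :
    SibTop Z₁ x y t st (merge (InCS Z₁ st w t) o i) ↔
      (tDinS Z₁ st t w i ∧ SibTop Z₁ x y w (stOutS Z₁ st w t) o) ∨ (tRinS Z₁ st t w i ∧ SibTop Z₁ x y w (stOutS Z₁ st w t) o) ∨
        (tNinS Z₁ st t w i ∧ False) := by
  have htC : t ∈ side Z₁ st w t := mem_reach_self _ _
  unfold SibTop tDinS tRinS tNinS
  rw [RdS_st_iff_out Z₁ st w t ht _ hx hy, RdS_st_iff_through Z₁ st w t ht _ hx htC,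
    RdS_st_iff_through Z₁ st w t ht _ hy htC, MgS_st_iff_out Z₁ st w t ht _ hx hy,
    RdS_stOutS_merge, RdS_stOutS_merge, RdS_stOutS_merge, RdS_stInS_merge, MgS_stOutS_merge]
  by_cases hR : RdS Z₁ (stInS Z₁ st w t) i w t <;> by_cases hB : MgS Z₁ (stInS Z₁ st w t) i w t
  all_goals
    simp only [hR, hB, and_true, and_false, not_true_eq_false, not_false_eq_true, true_and, false_and, or_false,
      false_or]

variable [Fintype E₁] [DecidableEq E₁]

open Classical in
/-- **THE SIBLING ACROSS A CUT VERTEX SEPARATING ITS TERMINAL**: `Sib(x, y; w)` on the near side gives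
`Sib(x, y; t)` on the host. -/
theorem sibDominationS_of_cutVertex_terminal (ht : t ≠ w) (hx : x ∉ side Z₁ st w t)
    (hy : y ∉ side Z₁ st w t) (h : SibDominationS Z₁ x y w (stOutS Z₁ st w t)) :
    SibDominationS Z₁ x y t st := by
  intro V hV
  have key := count_le_of_fibresS Z₁ st t w
    (fun ω => SibC₁ Z₁ x y t st ω ∨ SibC₃ Z₁ x y t st ω)
    (SibTop Z₁ x y t st)
    (fun o => SibC₁ Z₁ x y w (stOutS Z₁ st w t) o ∨ SibC₃ Z₁ x y w (stOutS Z₁ st w t) o)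
    (SibC₃ Z₁ x y w (stOutS Z₁ st w t)) (SibC₁ Z₁ x y w (stOutS Z₁ st w t)) (fun _ => False)
    (SibTop Z₁ x y w (stOutS Z₁ st w t)) (SibTop Z₁ x y w (stOutS Z₁ st w t)) (fun _ => False)
    (sibSrcS_merge_iff_terminal Z₁ st x y t w ht hx hy) (sibTopS_merge_iff_terminal Z₁ st x y t w ht hx hy)
    (fun V hV i => fibS_le_of_stOutS Z₁ st t w (fun o => SibC₁ Z₁ x y w (stOutS Z₁ st w t) o ∨ SibC₃ Z₁ x y w (stOutS Z₁ st w t) o)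
      (SibTop Z₁ x y w (stOutS Z₁ st w t)) (fun o i => or_congr (sibC₁_stOutS_merge' Z₁ st t w x y w o i)
      (sibC₃_stOutS_merge' Z₁ st t w x y w o i)) (sibTop_stOutS_merge' Z₁ st t w x y w)
      (fun V hV => (card_filter_congr' fun _ _ => Iff.rfl).trans_le ((h V hV).trans_eq (card_filter_congr' fun _ _ => Iff.rfl))) hV i)
    (fun V _ i => fibCS_false_le Z₁ st t w V _ i)
    (fun V hV i => by rw [add_comm]; exact fib_sibS_le Z₁ st x y t w hV h i) V hV
  exact (card_filter_congr' fun _ _ => Iff.rfl).trans_le (key.trans_eq (card_filter_congr' fun _ _ => Iff.rfl))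

end Terminal

/-! ## Case B: the cut vertex separates the first mark -/

section MarkX

variable (x y t w : V₁)

open Classical in
/-- The sibling's classes split across a cut vertex separating the mark `x`. -/
theorem sibSrcS_merge_iff_markx (hx : x ≠ w) (hy : y ∉ side Z₁ st w x)
    (ht : t ∉ side Z₁ st w x) (o i : E₁ → Bool) :
    (SibC₁ Z₁ x y t st (merge (InCS Z₁ st w x) o i) ∨
        SibC₃ Z₁ x y t st (merge (InCS Z₁ st w x) o i)) ↔
      (tDinS Z₁ st x w i ∧ (SibC₁ Z₁ w y t (stOutS Z₁ st w x) o ∨ SibC₃ Z₁ w y t (stOutS Z₁ st w x) o)) ∨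
        (tRinS Z₁ st x w i ∧ False) ∨
        (tBinS Z₁ st x w i ∧ (RdS Z₁ (stOutS Z₁ st w x) o y t ∧ MgS Z₁ (stOutS Z₁ st w x) o y w)) ∨
        (tNinS Z₁ st x w i ∧ False) := by
  have hxC : x ∈ side Z₁ st w x := mem_reach_self _ _
  unfold SibC₁ SibC₃ tDinS tRinS tBinS tNinS
  rw [RdS_st_iff_through' Z₁ st w x hx _ hy hxC, RdS_st_iff_through' Z₁ st w x hx _ ht hxC,
    RdS_st_iff_out Z₁ st w x hx _ hy ht, MgS_st_iff_through' Z₁ st w x hx _ hy hxC,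
    MgS_st_iff_through' Z₁ st w x hx _ ht hxC, MgS_st_iff_out Z₁ st w x hx _ hy ht,
    RdS_stOutS_merge, RdS_stOutS_merge, RdS_stOutS_merge, RdS_stInS_merge, MgS_stOutS_merge, MgS_stOutS_merge,
    MgS_stOutS_merge, MgS_stInS_merge, RdS_comm Z₁ _ o w y, RdS_comm Z₁ _ o w t, MgS_comm Z₁ _ o w y,
    MgS_comm Z₁ _ o w t]
  by_cases hR : RdS Z₁ (stInS Z₁ st w x) i w x <;> by_cases hB : MgS Z₁ (stInS Z₁ st w x) i w x
  all_goals
    simp only [hR, hB, and_true, and_false, not_true_eq_false, not_false_eq_true, true_and, false_and, or_false,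
      false_or]

open Classical in
/-- The sibling's target splits across a cut vertex separating the mark `x`. -/
theorem sibTopS_merge_iff_markx (hx : x ≠ w) (hy : y ∉ side Z₁ st w x)
    (ht : t ∉ side Z₁ st w x) (o i : E₁ → Bool) :
    SibTop Z₁ x y t st (merge (InCS Z₁ st w x) o i) ↔
      (tDinS Z₁ st x w i ∧ SibTop Z₁ w y t (stOutS Z₁ st w x) o) ∨
        (tRinS Z₁ st x w i ∧ (RdS Z₁ (stOutS Z₁ st w x) o y t ∧ RdS Z₁ (stOutS Z₁ st w x) o y w ∧
          RdS Z₁ (stOutS Z₁ st w x) o t w)) ∨ (tNinS Z₁ st x w i ∧ False) := by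
  have hxC : x ∈ side Z₁ st w x := mem_reach_self _ _
  unfold SibTop tDinS tRinS tNinS
  rw [RdS_st_iff_through' Z₁ st w x hx _ hy hxC, RdS_st_iff_through' Z₁ st w x hx _ ht hxC,
    RdS_st_iff_out Z₁ st w x hx _ hy ht, MgS_st_iff_through' Z₁ st w x hx _ hy hxC,
    RdS_stOutS_merge, RdS_stOutS_merge, RdS_stOutS_merge, RdS_stInS_merge, MgS_stOutS_merge, MgS_stInS_merge,
    RdS_comm Z₁ _ o w y, RdS_comm Z₁ _ o w t, MgS_comm Z₁ _ o w y]
  by_cases hR : RdS Z₁ (stInS Z₁ st w x) i w x <;> by_cases hB : MgS Z₁ (stInS Z₁ st w x) i w x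
  all_goals
    simp only [hR, hB, and_true, and_false, not_true_eq_false, not_false_eq_true, true_and, false_and, or_false,
      false_or]
  all_goals tauto

variable [Fintype E₁] [DecidableEq E₁]

open Classical in
/-- **THE SIBLING ACROSS A CUT VERTEX SEPARATING ITS FIRST MARK**: `Sib(w, y; t)` on the near side gives
`Sib(x, y; t)` on the host (the `B`-fibres are THEOREM (TWO-MARK DOMINATION) in the window `y ~_R t`). -/
theorem sibDominationS_of_cutVertex_markx (hx : x ≠ w) (hy : y ∉ side Z₁ st w x)
    (ht : t ∉ side Z₁ st w x) (h : SibDominationS Z₁ w y t (stOutS Z₁ st w x)) :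
    SibDominationS Z₁ x y t st := by
  intro V hV
  have key := count_le_of_fibresS Z₁ st x w
    (fun ω => SibC₁ Z₁ x y t st ω ∨ SibC₃ Z₁ x y t st ω)
    (SibTop Z₁ x y t st)
    (fun o => SibC₁ Z₁ w y t (stOutS Z₁ st w x) o ∨ SibC₃ Z₁ w y t (stOutS Z₁ st w x) o) (fun _ => False)
    (fun o => RdS Z₁ (stOutS Z₁ st w x) o y t ∧ MgS Z₁ (stOutS Z₁ st w x) o y w) (fun _ => False)
    (SibTop Z₁ w y t (stOutS Z₁ st w x))
    (fun o => RdS Z₁ (stOutS Z₁ st w x) o y t ∧ RdS Z₁ (stOutS Z₁ st w x) o y w ∧ RdS Z₁ (stOutS Z₁ st w x) o t w)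
    (fun _ => False)
    (sibSrcS_merge_iff_markx Z₁ st x y t w hx hy ht) (sibTopS_merge_iff_markx Z₁ st x y t w hx hy ht)
    (fun V hV i => fibS_le_of_stOutS Z₁ st x w (fun o => SibC₁ Z₁ w y t (stOutS Z₁ st w x) o ∨ SibC₃ Z₁ w y t (stOutS Z₁ st w x) o)
      (SibTop Z₁ w y t (stOutS Z₁ st w x)) (fun o i => or_congr (sibC₁_stOutS_merge' Z₁ st x w w y t o i)
      (sibC₃_stOutS_merge' Z₁ st x w w y t o i)) (sibTop_stOutS_merge' Z₁ st x w w y t)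
      (fun V hV => (card_filter_congr' fun _ _ => Iff.rfl).trans_le ((h V hV).trans_eq (card_filter_congr' fun _ _ => Iff.rfl))) hV i)
    (fun V _ i => fibCS_false_le Z₁ st x w V _ i)
    (fun V hV i => by
      have hfalse : fibCS Z₁ st x w V (fun _ => False) i = 0 := by
        unfold fibCS
        simp only [and_false, Finset.filter_false, Finset.card_empty]
      rw [hfalse, zero_add]
      exact fibS_le_of_stOutS Z₁ st x w (fun o => RdS Z₁ (stOutS Z₁ st w x) o y t ∧ MgS Z₁ (stOutS Z₁ st w x) o y w)
        (fun o => RdS Z₁ (stOutS Z₁ st w x) o y t ∧ RdS Z₁ (stOutS Z₁ st w x) o y w ∧ RdS Z₁ (stOutS Z₁ st w x) o t w)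
        (fun o i => by simp only [RdS_stOutS_merge, MgS_stOutS_merge]) (fun o i => by simp only [RdS_stOutS_merge])
        (fun V hV => (card_filter_congr' fun _ _ => Iff.rfl).trans_le ((count_window_tw Z₁ (stOutS Z₁ st w x) y w t hV).trans_eq (card_filter_congr' fun _ _ => Iff.rfl))) hV i) V hV
  exact (card_filter_congr' fun _ _ => Iff.rfl).trans_le (key.trans_eq (card_filter_congr' fun _ _ => Iff.rfl))

end MarkX

/-! ## Case B′: the cut vertex separates the second mark -/

section MarkY

variable (x y t w : V₁)

open Classical in
/-- The sibling's classes split across a cut vertex separating the mark `y`. -/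
theorem sibSrcS_merge_iff_marky (hy : y ≠ w) (hx : x ∉ side Z₁ st w y)
    (ht : t ∉ side Z₁ st w y) (o i : E₁ → Bool) :
    (SibC₁ Z₁ x y t st (merge (InCS Z₁ st w y) o i) ∨
        SibC₃ Z₁ x y t st (merge (InCS Z₁ st w y) o i)) ↔
      (tDinS Z₁ st y w i ∧ (SibC₁ Z₁ x w t (stOutS Z₁ st w y) o ∨ SibC₃ Z₁ x w t (stOutS Z₁ st w y) o)) ∨
        (tRinS Z₁ st y w i ∧ (MgS Z₁ (stOutS Z₁ st w y) o x t ∧ RdS Z₁ (stOutS Z₁ st w y) o x w)) ∨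
        (tBinS Z₁ st y w i ∧ False) ∨ (tNinS Z₁ st y w i ∧ False) := by
  have hyC : y ∈ side Z₁ st w y := mem_reach_self _ _
  unfold SibC₁ SibC₃ tDinS tRinS tBinS tNinS
  rw [RdS_st_iff_through Z₁ st w y hy _ hx hyC, RdS_st_iff_out Z₁ st w y hy _ hx ht,
    RdS_st_iff_through' Z₁ st w y hy _ ht hyC, MgS_st_iff_through Z₁ st w y hy _ hx hyC,
    MgS_st_iff_out Z₁ st w y hy _ hx ht, MgS_st_iff_through' Z₁ st w y hy _ ht hyC,
    RdS_stOutS_merge, RdS_stOutS_merge, RdS_stOutS_merge, RdS_stInS_merge, MgS_stOutS_merge, MgS_stOutS_merge,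
    MgS_stOutS_merge, MgS_stInS_merge, RdS_comm Z₁ _ o w t, MgS_comm Z₁ _ o w t]
  by_cases hR : RdS Z₁ (stInS Z₁ st w y) i w y <;> by_cases hB : MgS Z₁ (stInS Z₁ st w y) i w y
  all_goals
    simp only [hR, hB, and_true, and_false, not_true_eq_false, not_false_eq_true, true_and, false_and, or_false,
      false_or]
  all_goals tauto

open Classical in
/-- The sibling's target splits across a cut vertex separating the mark `y`. -/
theorem sibTopS_merge_iff_marky (hy : y ≠ w) (hx : x ∉ side Z₁ st w y)
    (ht : t ∉ side Z₁ st w y) (o i : E₁ → Bool) :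
    SibTop Z₁ x y t st (merge (InCS Z₁ st w y) o i) ↔
      (tDinS Z₁ st y w i ∧ SibTop Z₁ x w t (stOutS Z₁ st w y) o) ∨
        (tRinS Z₁ st y w i ∧ (RdS Z₁ (stOutS Z₁ st w y) o x w ∧ RdS Z₁ (stOutS Z₁ st w y) o x t ∧
          RdS Z₁ (stOutS Z₁ st w y) o t w)) ∨ (tNinS Z₁ st y w i ∧ False) := by
  have hyC : y ∈ side Z₁ st w y := mem_reach_self _ _
  unfold SibTop tDinS tRinS tNinS
  rw [RdS_st_iff_through Z₁ st w y hy _ hx hyC, RdS_st_iff_out Z₁ st w y hy _ hx ht,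
    RdS_st_iff_through' Z₁ st w y hy _ ht hyC, MgS_st_iff_through Z₁ st w y hy _ hx hyC,
    RdS_stOutS_merge, RdS_stOutS_merge, RdS_stOutS_merge, RdS_stInS_merge, MgS_stOutS_merge, MgS_stInS_merge,
    RdS_comm Z₁ _ o w t]
  by_cases hR : RdS Z₁ (stInS Z₁ st w y) i w y <;> by_cases hB : MgS Z₁ (stInS Z₁ st w y) i w y
  all_goals
    simp only [hR, hB, and_true, and_false, not_true_eq_false, not_false_eq_true, true_and, false_and, or_false,
      false_or]

variable [Fintype E₁] [DecidableEq E₁]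

open Classical in
/-- **THE SIBLING ACROSS A CUT VERTEX SEPARATING ITS SECOND MARK**: `Sib(x, w; t)` on the near side gives
`Sib(x, y; t)` on the host (the `R`-fibres are THEOREM (TWO-MARK DOMINATION) in the window `x ~_R w`). -/
theorem sibDominationS_of_cutVertex_marky (hy : y ≠ w) (hx : x ∉ side Z₁ st w y)
    (ht : t ∉ side Z₁ st w y) (h : SibDominationS Z₁ x w t (stOutS Z₁ st w y)) :
    SibDominationS Z₁ x y t st := by
  intro V hV
  have key := count_le_of_fibresS Z₁ st y w
    (fun ω => SibC₁ Z₁ x y t st ω ∨ SibC₃ Z₁ x y t st ω)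
    (SibTop Z₁ x y t st)
    (fun o => SibC₁ Z₁ x w t (stOutS Z₁ st w y) o ∨ SibC₃ Z₁ x w t (stOutS Z₁ st w y) o)
    (fun o => MgS Z₁ (stOutS Z₁ st w y) o x t ∧ RdS Z₁ (stOutS Z₁ st w y) o x w) (fun _ => False) (fun _ => False)
    (SibTop Z₁ x w t (stOutS Z₁ st w y))
    (fun o => RdS Z₁ (stOutS Z₁ st w y) o x w ∧ RdS Z₁ (stOutS Z₁ st w y) o x t ∧ RdS Z₁ (stOutS Z₁ st w y) o t w)
    (fun _ => False)
    (sibSrcS_merge_iff_marky Z₁ st x y t w hy hx ht) (sibTopS_merge_iff_marky Z₁ st x y t w hy hx ht)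
    (fun V hV i => fibS_le_of_stOutS Z₁ st y w (fun o => SibC₁ Z₁ x w t (stOutS Z₁ st w y) o ∨ SibC₃ Z₁ x w t (stOutS Z₁ st w y) o)
      (SibTop Z₁ x w t (stOutS Z₁ st w y)) (fun o i => or_congr (sibC₁_stOutS_merge' Z₁ st y w x w t o i)
      (sibC₃_stOutS_merge' Z₁ st y w x w t o i)) (sibTop_stOutS_merge' Z₁ st y w x w t)
      (fun V hV => (card_filter_congr' fun _ _ => Iff.rfl).trans_le ((h V hV).trans_eq (card_filter_congr' fun _ _ => Iff.rfl))) hV i)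
    (fun V _ i => fibCS_false_le Z₁ st y w V _ i)
    (fun V hV i => by
      have hfalse : fibCS Z₁ st y w V (fun _ => False) i = 0 := by
        unfold fibCS
        simp only [and_false, Finset.filter_false, Finset.card_empty]
      rw [hfalse, add_zero]
      exact fibS_le_of_stOutS Z₁ st y w (fun o => MgS Z₁ (stOutS Z₁ st w y) o x t ∧ RdS Z₁ (stOutS Z₁ st w y) o x w)
        (fun o => RdS Z₁ (stOutS Z₁ st w y) o x w ∧ RdS Z₁ (stOutS Z₁ st w y) o x t ∧ RdS Z₁ (stOutS Z₁ st w y) o t w)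
        (fun o i => by simp only [RdS_stOutS_merge, MgS_stOutS_merge]) (fun o i => by simp only [RdS_stOutS_merge])
        (fun V hV => (card_filter_congr' fun _ _ => and_congr_right fun _ => and_comm).trans_le
          ((count_window' Z₁ (stOutS Z₁ st w y) x t w hV).trans_eq (card_filter_congr' fun _ _ => Iff.rfl))) hV i) V hV
  exact (card_filter_congr' fun _ _ => Iff.rfl).trans_le (key.trans_eq (card_filter_congr' fun _ _ => Iff.rfl))

end MarkY

end MultiExit

end ZoneZ

end PercRepro
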